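import Literature.NumberTheory.DiophantineGeometry.GenEllDeCoverFarFromCusps
import Literature.NumberTheory.DiophantineGeometry.GenEllDePropernessFamily

/-!
# [GenEll] Thm 2.1 for `ℙ¹` (route piece W7, FAMILY version): `φ_c = β ∘ t_c` sends points far
# from the fibre `E_φ` to points far from the cusps `0, 1, ∞` — at `∞` and at `2`

Support theorem for the number-field-only proof architecture of `GenEllTwo` (stmt-ABC-19679;
S. Mochizuki, *Arithmetic elliptic curves in general position*, Math. J. Okayama Univ. **52** (2010),
Thm. 2.1, proof p. 12: "by the compactness of the set of rational points … over any finite extension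
of `ℚ_v` … contained in a compactly bounded subset" [cite: MochizukiGenEll2010, Thm 2.1 p.12];
package map `GENELLTWO-P1ROUTE.md` of seat abc-iut-S6, W7 «properness», and S6 OWNER RULING #6 +
AMENDMENT (2026-08-26): the primary route uses the FAMILY `t_c := 1/r + c·r^k/(1 − 2x)`,
`c ∈ ℚ^×` («W7 (d031): per (c, T)»)).  This file is the `c`-parametric twin of
`GenEllDeCoverFarFromCusps` (`c = 1`); setting (all expressions written out, no definitions): the
cover `D_e : r^e = x(1 − x)` (`2k = e + 1`), `t_c = r⁻¹ + c·r^k/(1 − 2x)`, the Belyi factor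
`β = p/q`, `p, q ∈ ℚ[X]` (or `L[X]` at one place), `deg p = deg q = deg (p − q)` (`β(∞) ∉ {0,1,∞}`;
for the primary route `β = ρ_T = β_T ∘ ψ_T`), `φ_c := β ∘ t_c`, and the fibre
`E_φ = {P' : p(t_c P') = 0 ∨ q(t_c P') = 0 ∨ (p − q)(t_c P') = 0}` (non-pole curve points).
* `exists_annulus_of_far_fibre_c` (+ `_of_properSpace`, `_of_submodule`): one place (any prime —
  the compactness input `isCompact_curveFar_of_submodule` is prime-agnostic), `ρ`-far from
  `E_φ(L)` ⟹ `φ_c` in the annulus (`exists_lower_bound_tc_sub` ∘ W7-β `exists_annulus_of_far`).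
* `exists_farFromCusps_phi_c` (+ `_of_x_far`): conjugates at `∞` and `2` far from `E_φ` ⟹
  `NFPoint.FarFromCusps {2} ρ'`, `ρ'` uniform in `[F:ℚ] ≤ N` (`c ∈ ℚ^×` is fixed by every
  embedding).
Classical; nothing here bears on [IUTchIII] Cor. 3.12. -/

namespace Literature.NumberTheory.DiophantineGeometry.GenEll

open Metric Set

/-! ### Composition: far from the fibre `E_φ` ⟹ `φ = β ∘ t` lands in the annulus (one place) -/

section Compose

variable {L : Type*} [NormedField L] [IsAlgClosed L]

open Polynomial

/-- **W7 at one place, family `t_c`.** `L` an algebraically closed normed field (`ℂ`, or `Q̄_2`); the cover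
`D_e : r^e = x(1−x)` with `t_c = r⁻¹ + c·r^k/(1−2x)` (`2k = e+1`, `c ≠ 0`); `β = p/q` with
`deg p = deg q = deg(p − q)` (`β(∞) ∉ {0,1,∞}`); `φ := β ∘ t`. Let `D ⊆ L × L` be a point-domain
whose curve points in every window `‖x‖ ≤ R` that are `ρ`-far from any given set form a compact set
(all of `ℂ²`; or `K²` for a finite `K/ℚ_2`). Then there is `ρ' ∈ (0, 1]` such that every non-pole
curve point `P ∈ D` lying at sup-distance `≥ ρ` from every point of the fibre
`E_φ = {P' : p(t P') = 0 ∨ q(t P') = 0 ∨ (p−q)(t P') = 0}` (`= φ⁻¹{0, ∞, 1}`) has `φ(P)` in the annulus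
`ρ' ≤ ‖φ P‖ ≤ ρ'⁻¹`, `ρ' ≤ ‖φ P − 1‖`. [cite: MochizukiGenEll2010, Thm 2.1 p.12] -/
theorem exists_annulus_of_far_fibre_c {e k : ℕ} (he : 0 < e) (hk : 2 * k = e + 1) {c : L}
    (hc : c ≠ 0) {p q : L[X]}
    {n : ℕ} (hpn : p.natDegree = n) (hqn : q.natDegree = n) (hpqn : (p - q).natDegree = n)
    (hp0 : p ≠ 0) (hq0 : q ≠ 0) (hne : p ≠ q) {ρ : ℝ} (hρ : 0 < ρ) (D : Set (L × L))
    (hD : ∀ (R : ℝ) (Z : Set (L × L)), IsCompact {P : L × L | P ∈ D ∧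
      P.2 ^ e = P.1 * (1 - P.1) ∧ ‖P.1‖ ≤ R ∧ ∀ z ∈ Z, ρ ≤ dist P z}) :
    ∃ ρ' : ℝ, 0 < ρ' ∧ ρ' ≤ 1 ∧ ∀ P ∈ D, P.2 ^ e = P.1 * (1 - P.1) → P.2 ≠ 0 → 1 - 2 * P.1 ≠ 0 →
      (∀ P' : L × L, P'.2 ^ e = P'.1 * (1 - P'.1) → P'.2 ≠ 0 → 1 - 2 * P'.1 ≠ 0 →
        (p.eval (P'.2⁻¹ + c * P'.2 ^ k / (1 - 2 * P'.1)) = 0 ∨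
          q.eval (P'.2⁻¹ + c * P'.2 ^ k / (1 - 2 * P'.1)) = 0 ∨
          (p - q).eval (P'.2⁻¹ + c * P'.2 ^ k / (1 - 2 * P'.1)) = 0) → ρ ≤ dist P P') →
      ρ' ≤ ‖p.eval (P.2⁻¹ + c * P.2 ^ k / (1 - 2 * P.1)) / q.eval (P.2⁻¹ + c * P.2 ^ k / (1 - 2 * P.1))‖ ∧
      ‖p.eval (P.2⁻¹ + c * P.2 ^ k / (1 - 2 * P.1)) / q.eval (P.2⁻¹ + c * P.2 ^ k / (1 - 2 * P.1))‖ ≤ ρ'⁻¹ ∧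
      ρ' ≤ ‖p.eval (P.2⁻¹ + c * P.2 ^ k / (1 - 2 * P.1)) / q.eval (P.2⁻¹ + c * P.2 ^ k / (1 - 2 * P.1)) - 1‖
      := by
  classical
  -- the finite set `B = β⁻¹{0, ∞, 1} ∩ 𝔸¹` of roots of `p`, `q`, `p − q`
  set B : Finset L := (p.roots + q.roots + (p - q).roots).toFinset with hB
  have hBp : ∀ a ∈ p.roots, a ∈ (B : Set L) := fun a ha => by
    simp only [Finset.mem_coe, hB, Multiset.mem_toFinset, Multiset.mem_add]; exact Or.inl (Or.inl ha)
  have hBq : ∀ a ∈ q.roots, a ∈ (B : Set L) := fun a ha => by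
    simp only [Finset.mem_coe, hB, Multiset.mem_toFinset, Multiset.mem_add]; exact Or.inl (Or.inr ha)
  have hBpq : ∀ a ∈ (p - q).roots, a ∈ (B : Set L) := fun a ha => by
    simp only [Finset.mem_coe, hB, Multiset.mem_toFinset, Multiset.mem_add]; exact Or.inr ha
  have hBmem : ∀ b ∈ B, p.eval b = 0 ∨ q.eval b = 0 ∨ (p - q).eval b = 0 := by
    intro b hb
    simp only [hB, Multiset.mem_toFinset, Multiset.mem_add] at hb
    rcases hb with (hb | hb) | hb
    · exact Or.inl ((mem_roots hp0).mp hb)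
    · exact Or.inr (Or.inl ((mem_roots hq0).mp hb))
    · exact Or.inr (Or.inr ((mem_roots (sub_ne_zero.mpr hne)).mp hb))
  -- a bound for the norms on `B`
  set M : ℝ := ∑ b ∈ B, ‖b‖ with hM
  have hM0 : 0 ≤ M := Finset.sum_nonneg fun _ _ => norm_nonneg _
  have hMb : ∀ b ∈ (B : Set L), ‖b‖ ≤ M := fun b hb =>
    Finset.single_le_sum (f := fun b => ‖b‖) (fun _ _ => norm_nonneg _) (Finset.mem_coe.mp hb)
  -- the fibre set `Z = t⁻¹(B)` (non-pole curve points)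
  set Z : Set (L × L) := {P' : L × L | P'.2 ^ e = P'.1 * (1 - P'.1) ∧ P'.2 ≠ 0 ∧
    1 - 2 * P'.1 ≠ 0 ∧ P'.2⁻¹ + c * P'.2 ^ k / (1 - 2 * P'.1) ∈ B} with hZ
  -- W7-t: a uniform `ρ_t`
  obtain ⟨ρt, hρt0, hρt⟩ := exists_lower_bound_tc_sub (L := L) he hk hc B Z
    (fun b hb P' hc hr hs ht => ⟨hc, hr, hs, by rw [ht]; exact hb⟩) hρ D (fun R => hD R Z)
  -- W7-β at separation `ρ_t`
  obtain ⟨ρ', hρ'0, hρ'1, hann⟩ := exists_annulus_of_far (IsAlgClosed.splits p)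
    (IsAlgClosed.splits q) (IsAlgClosed.splits _) hpn hqn hpqn hp0 hq0 hne hBp hBq hBpq hM0 hMb hρt0
  refine ⟨ρ', hρ'0, hρ'1, fun P hPD hcurve hr hs hfar => ?_⟩
  -- `P` is `ρ`-far from `Z`
  have hfarZ : ∀ z ∈ Z, ρ ≤ dist P z := by
    rintro z ⟨hc, hzr, hzs, hzB⟩
    exact hfar z hc hzr hzs (hBmem _ hzB)
  -- hence `t P` is `ρ_t`-far from `B`, and the annulus statement follows
  exact hann _ fun b hb => hρt P hPD hcurve hr hs hfarZ b (Finset.mem_coe.mp hb)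

/-- **W7 at the archimedean place, family `t_c`** (`L` proper, e.g. `ℂ`). [cite: MochizukiGenEll2010, Thm 2.1 p.12] -/
theorem exists_annulus_of_far_fibre_c_of_properSpace [ProperSpace L] {e k : ℕ} (he : 0 < e)
    (hk : 2 * k = e + 1) {c : L} (hc : c ≠ 0) {p q : L[X]} {n : ℕ} (hpn : p.natDegree = n) (hqn : q.natDegree = n)
    (hpqn : (p - q).natDegree = n) (hp0 : p ≠ 0) (hq0 : q ≠ 0) (hne : p ≠ q) {ρ : ℝ}
    (hρ : 0 < ρ) :
    ∃ ρ' : ℝ, 0 < ρ' ∧ ρ' ≤ 1 ∧ ∀ P : L × L, P.2 ^ e = P.1 * (1 - P.1) → P.2 ≠ 0 →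
      1 - 2 * P.1 ≠ 0 →
      (∀ P' : L × L, P'.2 ^ e = P'.1 * (1 - P'.1) → P'.2 ≠ 0 → 1 - 2 * P'.1 ≠ 0 →
        (p.eval (P'.2⁻¹ + c * P'.2 ^ k / (1 - 2 * P'.1)) = 0 ∨
          q.eval (P'.2⁻¹ + c * P'.2 ^ k / (1 - 2 * P'.1)) = 0 ∨
          (p - q).eval (P'.2⁻¹ + c * P'.2 ^ k / (1 - 2 * P'.1)) = 0) → ρ ≤ dist P P') →
      ρ' ≤ ‖p.eval (P.2⁻¹ + c * P.2 ^ k / (1 - 2 * P.1)) / q.eval (P.2⁻¹ + c * P.2 ^ k / (1 - 2 * P.1))‖ ∧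
      ‖p.eval (P.2⁻¹ + c * P.2 ^ k / (1 - 2 * P.1)) / q.eval (P.2⁻¹ + c * P.2 ^ k / (1 - 2 * P.1))‖ ≤ ρ'⁻¹ ∧
      ρ' ≤ ‖p.eval (P.2⁻¹ + c * P.2 ^ k / (1 - 2 * P.1)) / q.eval (P.2⁻¹ + c * P.2 ^ k / (1 - 2 * P.1)) - 1‖
      := by
  obtain ⟨ρ', h0, h1, h⟩ := exists_annulus_of_far_fibre_c he hk hc hpn hqn hpqn hp0 hq0 hne hρ
    (Set.univ : Set (L × L)) (fun R Z => by
      simpa only [Set.mem_univ, true_and] using isCompact_curveFar_of_properSpace (L := L) he R ρ Z)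
  exact ⟨ρ', h0, h1, fun P => h P (Set.mem_univ P)⟩

/-- **W7 at a nonarchimedean place (any prime), over a finite extension, family `t_c`** (point-domain `K × K`, `K ⊆ Q̄_p` a
finite-dimensional `ℚ_p`-submodule). [cite: MochizukiGenEll2010, Thm 2.1 p.12] -/
theorem exists_annulus_of_far_fibre_c_of_submodule {𝕜 : Type*} [NontriviallyNormedField 𝕜]
    [LocallyCompactSpace 𝕜] [NormedSpace 𝕜 L] (K : Submodule 𝕜 L) [FiniteDimensional 𝕜 K]
    {e k : ℕ} (he : 0 < e) (hk : 2 * k = e + 1) {c : L} (hc : c ≠ 0) {p q : L[X]} {n : ℕ}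
    (hpn : p.natDegree = n)
    (hqn : q.natDegree = n) (hpqn : (p - q).natDegree = n) (hp0 : p ≠ 0) (hq0 : q ≠ 0)
    (hne : p ≠ q) {ρ : ℝ} (hρ : 0 < ρ) :
    ∃ ρ' : ℝ, 0 < ρ' ∧ ρ' ≤ 1 ∧ ∀ P : L × L, P.1 ∈ K → P.2 ∈ K → P.2 ^ e = P.1 * (1 - P.1) →
      P.2 ≠ 0 → 1 - 2 * P.1 ≠ 0 →
      (∀ P' : L × L, P'.2 ^ e = P'.1 * (1 - P'.1) → P'.2 ≠ 0 → 1 - 2 * P'.1 ≠ 0 →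
        (p.eval (P'.2⁻¹ + c * P'.2 ^ k / (1 - 2 * P'.1)) = 0 ∨
          q.eval (P'.2⁻¹ + c * P'.2 ^ k / (1 - 2 * P'.1)) = 0 ∨
          (p - q).eval (P'.2⁻¹ + c * P'.2 ^ k / (1 - 2 * P'.1)) = 0) → ρ ≤ dist P P') →
      ρ' ≤ ‖p.eval (P.2⁻¹ + c * P.2 ^ k / (1 - 2 * P.1)) / q.eval (P.2⁻¹ + c * P.2 ^ k / (1 - 2 * P.1))‖ ∧
      ‖p.eval (P.2⁻¹ + c * P.2 ^ k / (1 - 2 * P.1)) / q.eval (P.2⁻¹ + c * P.2 ^ k / (1 - 2 * P.1))‖ ≤ ρ'⁻¹ ∧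
      ρ' ≤ ‖p.eval (P.2⁻¹ + c * P.2 ^ k / (1 - 2 * P.1)) / q.eval (P.2⁻¹ + c * P.2 ^ k / (1 - 2 * P.1)) - 1‖
      := by
  obtain ⟨ρ', h0, h1, h⟩ := exists_annulus_of_far_fibre_c he hk hc hpn hqn hpqn hp0 hq0 hne hρ
    {P : L × L | P.1 ∈ K ∧ P.2 ∈ K} (fun R Z => by
      simpa only [Set.mem_setOf_eq] using isCompact_curveFar_of_submodule (L := L) K he R ρ Z)
  exact ⟨ρ', h0, h1, fun P hx hr => h P ⟨hx, hr⟩⟩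

end Compose

/-! ### The number-field statement: `φ(P)` is far from the cusps at `∞` and at `2` -/

section NumberField

open Polynomial NumberField

/-- Transport of `t` under a ring homomorphism of fields. [folklore] -/
private theorem map_tDeC {F L : Type*} [Field F] [CharZero F] [Field L] [CharZero L]
    (σ : F →+* L) (c : ℚ) (x r : F) (k : ℕ) :
    σ (r⁻¹ + (c : F) * r ^ k / (1 - 2 * x)) = (σ r)⁻¹ + (c : L) * (σ r) ^ k / (1 - 2 * σ x) := by
  simp [map_add, map_inv₀, map_div₀, map_pow, map_sub, map_mul, map_ofNat, map_ratCast]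

/-- Transport of `φ = β ∘ t` under a ring homomorphism of fields. [folklore] -/
private theorem map_phiDeC {F L : Type*} [Field F] [CharZero F] [Field L] [CharZero L] (σ : F →+* L)
    (p q : ℚ[X]) (y : F) : σ (aeval y p / aeval y q) = aeval (σ y) p / aeval (σ y) q := by
  rw [map_div₀]
  have h : ∀ f : ℚ[X], σ (aeval y f) = aeval (σ y) f := fun f => by
    change σ.toRatAlgHom (aeval y f) = aeval (σ.toRatAlgHom y) f
    rw [aeval_algHom_apply]
  rw [h p, h q]

/-- Mapped data keep degrees and non-degeneracy (bookkeeping). [folklore] -/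
private theorem mapped_hypsC {L : Type*} [Field L] [CharZero L] {p q : ℚ[X]} {n : ℕ}
    (hpn : p.natDegree = n) (hqn : q.natDegree = n) (hpqn : (p - q).natDegree = n)
    (hp0 : p ≠ 0) (hq0 : q ≠ 0) (hne : p ≠ q) :
    (p.map (algebraMap ℚ L)).natDegree = n ∧ (q.map (algebraMap ℚ L)).natDegree = n ∧
      (p.map (algebraMap ℚ L) - q.map (algebraMap ℚ L)).natDegree = n ∧
      p.map (algebraMap ℚ L) ≠ 0 ∧ q.map (algebraMap ℚ L) ≠ 0 ∧
      p.map (algebraMap ℚ L) ≠ q.map (algebraMap ℚ L) := by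
  have hinj : Function.Injective (algebraMap ℚ L) := (algebraMap ℚ L).injective
  refine ⟨by rw [natDegree_map_eq_of_injective hinj, hpn],
    by rw [natDegree_map_eq_of_injective hinj, hqn], ?_, ?_, ?_, ?_⟩
  · rw [← Polynomial.map_sub, natDegree_map_eq_of_injective hinj, hpqn]
  · exact (Polynomial.map_ne_zero_iff hinj).mpr hp0
  · exact (Polynomial.map_ne_zero_iff hinj).mpr hq0
  · exact fun h => hne (Polynomial.map_injective _ hinj h)

/-- `aeval y f = (f.map (algebraMap ℚ L)).eval y`. [folklore] -/
private theorem aeval_eq_eval_mapC {L : Type*} [Field L] [CharZero L] (f : ℚ[X]) (y : L) :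
    aeval y f = (f.map (algebraMap ℚ L)).eval y := by
  rw [eval_map, aeval_def]

/-- The fibre condition in `aeval` form vs `eval`-of-`map` form. [folklore] -/
private theorem fibre_aeval_iffC {L : Type*} [Field L] [CharZero L] (p q : ℚ[X]) (y : L) :
    (aeval y p = 0 ∨ aeval y q = 0 ∨ aeval y (p - q) = 0) ↔
    ((p.map (algebraMap ℚ L)).eval y = 0 ∨ (q.map (algebraMap ℚ L)).eval y = 0 ∨
      (p.map (algebraMap ℚ L) - q.map (algebraMap ℚ L)).eval y = 0) := by
  rw [← Polynomial.map_sub, ← aeval_eq_eval_mapC, ← aeval_eq_eval_mapC, ← aeval_eq_eval_mapC]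

/-- Finite minimum of positive witnesses (bookkeeping). [folklore] -/
private theorem exists_pos_forall_of_antitoneC {α : Type*} (B : Finset α) (Q : α → ℝ → Prop)
    (hmono : ∀ b m m', 0 < m' → m' ≤ m → Q b m → Q b m')
    (h : ∀ b ∈ B, ∃ m : ℝ, 0 < m ∧ Q b m) : ∃ m : ℝ, 0 < m ∧ ∀ b ∈ B, Q b m := by
  classical
  induction B using Finset.induction_on with
  | empty => exact ⟨1, one_pos, by simp⟩
  | insert a B ha ih =>
    obtain ⟨m₁, hm₁, hQ₁⟩ := h a (Finset.mem_insert_self a B)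
    obtain ⟨m₂, hm₂, hQ₂⟩ := ih fun b hb => h b (Finset.mem_insert_of_mem hb)
    refine ⟨min m₁ m₂, lt_min hm₁ hm₂, fun b hb => ?_⟩
    rcases Finset.mem_insert.mp hb with rfl | hb
    · exact hmono _ _ _ (lt_min hm₁ hm₂) (min_le_left _ _) hQ₁
    · exact hmono _ _ _ (lt_min hm₁ hm₂) (min_le_right _ _) (hQ₂ b hb)

/-- **[GenEll] Thm 2.1 for `ℙ¹`, route piece W7 («properness»), family `t_c` (`c ∈ ℚ^×`).** For every `ρ > 0` and degree
bound `N` there is `ρ' ∈ (0, 1/2]` such that for every number field `F` with `[F:ℚ] ≤ N` and every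
non-pole `(x, r) ∈ D_e(F)` ALL of whose conjugates `(σx, σr)` — at `∞` and at `2` — lie at
sup-distance `≥ ρ` from every non-pole curve point of the fibre `E_φ = φ⁻¹{0, 1, ∞}`, the point
`φ_c(x, r) = β(t_c(x, r)) ∈ F` satisfies `NFPoint.FarFromCusps {2} ρ'` (W1). Archimedean: properness of `ℂ²`; `2`-adic:
properness of `K²` for each of the finitely many (Krasner) `K ⊆ Q̄_2` of degree `≤ N²` over `ℚ_2`,
`(σx, σr) ∈ ℚ_2⟮σx⟯ ⊔ ℚ_2⟮σr⟯`. [cite: MochizukiGenEll2010, Thm 2.1 p.12] -/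
theorem exists_farFromCusps_phi_c {e k : ℕ} (he : 0 < e) (hk : 2 * k = e + 1) {c : ℚ} (hc : c ≠ 0)
    {p q : ℚ[X]}
    {n : ℕ} (hpn : p.natDegree = n) (hqn : q.natDegree = n) (hpqn : (p - q).natDegree = n)
    (hp0 : p ≠ 0) (hq0 : q ≠ 0) (hne : p ≠ q) {ρ : ℝ} (hρ : 0 < ρ) (N : ℕ) :
    ∃ ρ' : ℝ, 0 < ρ' ∧ ρ' ≤ 1 / 2 ∧
      ∀ (F : Type) [Field F] [NumberField F], Module.finrank ℚ F ≤ N →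
      ∀ (x r : F), r ^ e = x * (1 - x) → r ≠ 0 → 1 - 2 * x ≠ 0 →
      (∀ σ : F →+* ℂ, ∀ P' : ℂ × ℂ, P'.2 ^ e = P'.1 * (1 - P'.1) → P'.2 ≠ 0 → 1 - 2 * P'.1 ≠ 0 →
        (aeval (P'.2⁻¹ + (c : ℂ) * P'.2 ^ k / (1 - 2 * P'.1)) p = 0 ∨
          aeval (P'.2⁻¹ + (c : ℂ) * P'.2 ^ k / (1 - 2 * P'.1)) q = 0 ∨
          aeval (P'.2⁻¹ + (c : ℂ) * P'.2 ^ k / (1 - 2 * P'.1)) (p - q) = 0) →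
        ρ ≤ dist ((σ x, σ r) : ℂ × ℂ) P') →
      (∀ σ : F →+* PadicAlgCl 2, ∀ P' : PadicAlgCl 2 × PadicAlgCl 2,
        P'.2 ^ e = P'.1 * (1 - P'.1) → P'.2 ≠ 0 → 1 - 2 * P'.1 ≠ 0 →
        (aeval (P'.2⁻¹ + (c : PadicAlgCl 2) * P'.2 ^ k / (1 - 2 * P'.1)) p = 0 ∨
          aeval (P'.2⁻¹ + (c : PadicAlgCl 2) * P'.2 ^ k / (1 - 2 * P'.1)) q = 0 ∨
          aeval (P'.2⁻¹ + (c : PadicAlgCl 2) * P'.2 ^ k / (1 - 2 * P'.1)) (p - q) = 0) →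
        ρ ≤ dist ((σ x, σ r) : PadicAlgCl 2 × PadicAlgCl 2) P') →
      NFPoint.FarFromCusps ({2} : Finset ℕ) ρ'
        ⟨F, aeval (r⁻¹ + (c : F) * r ^ k / (1 - 2 * x)) p /
          aeval (r⁻¹ + (c : F) * r ^ k / (1 - 2 * x)) q⟩ := by
  classical
  -- ARCHIMEDEAN constant
  obtain ⟨hpnC, hqnC, hpqnC, hp0C, hq0C, hneC⟩ := mapped_hypsC (L := ℂ) hpn hqn hpqn hp0 hq0 hne
  have hcC : (c : ℂ) ≠ 0 := Rat.cast_ne_zero.mpr hc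
  obtain ⟨ρ₁, hρ₁0, hρ₁1, harc⟩ := exists_annulus_of_far_fibre_c_of_properSpace (L := ℂ) he hk
    hcC hpnC hqnC hpqnC hp0C hq0C hneC hρ
  -- NONARCHIMEDEAN constant, uniform over the finitely many subfields of degree ≤ N * N
  haveI : IsScalarTower ℚ ℚ_[2] (PadicAlgCl 2) := IsScalarTower.of_algebraMap_eq (fun q => by simp)
  obtain ⟨hpn2, hqn2, hpqn2, hp02, hq02, hne2⟩ :=
    mapped_hypsC (L := PadicAlgCl 2) hpn hqn hpqn hp0 hq0 hne
  have hc2 : (c : PadicAlgCl 2) ≠ 0 := Rat.cast_ne_zero.mpr hc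
  set 𝒦 : Set (IntermediateField ℚ_[2] (PadicAlgCl 2)) :=
    {K | FiniteDimensional ℚ_[2] K ∧ Module.finrank ℚ_[2] K ≤ N * N} with h𝒦
  have h𝒦fin : 𝒦.Finite :=
    Literature.NumberTheory.LocalFields.finite_setOf_intermediateField_finrank_le 2 (N * N)
  have hperK : ∀ K ∈ h𝒦fin.toFinset, ∃ ρK : ℝ, 0 < ρK ∧ (ρK ≤ 1 ∧
      ∀ P : PadicAlgCl 2 × PadicAlgCl 2, P.1 ∈ K.toSubalgebra.toSubmodule →
        P.2 ∈ K.toSubalgebra.toSubmodule → P.2 ^ e = P.1 * (1 - P.1) → P.2 ≠ 0 → 1 - 2 * P.1 ≠ 0 →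
        (∀ P' : PadicAlgCl 2 × PadicAlgCl 2, P'.2 ^ e = P'.1 * (1 - P'.1) → P'.2 ≠ 0 →
          1 - 2 * P'.1 ≠ 0 →
          ((p.map (algebraMap ℚ (PadicAlgCl 2))).eval
              (P'.2⁻¹ + (c : PadicAlgCl 2) * P'.2 ^ k / (1 - 2 * P'.1)) = 0 ∨
            (q.map (algebraMap ℚ (PadicAlgCl 2))).eval
              (P'.2⁻¹ + (c : PadicAlgCl 2) * P'.2 ^ k / (1 - 2 * P'.1)) = 0 ∨
            (p.map (algebraMap ℚ (PadicAlgCl 2)) - q.map (algebraMap ℚ (PadicAlgCl 2))).eval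
              (P'.2⁻¹ + (c : PadicAlgCl 2) * P'.2 ^ k / (1 - 2 * P'.1)) = 0) → ρ ≤ dist P P') →
        ρK ≤ ‖(p.map (algebraMap ℚ (PadicAlgCl 2))).eval (P.2⁻¹ + (c : PadicAlgCl 2) * P.2 ^ k / (1 - 2 * P.1)) /
            (q.map (algebraMap ℚ (PadicAlgCl 2))).eval (P.2⁻¹ + (c : PadicAlgCl 2) * P.2 ^ k / (1 - 2 * P.1))‖ ∧
        ‖(p.map (algebraMap ℚ (PadicAlgCl 2))).eval (P.2⁻¹ + (c : PadicAlgCl 2) * P.2 ^ k / (1 - 2 * P.1)) /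
            (q.map (algebraMap ℚ (PadicAlgCl 2))).eval (P.2⁻¹ + (c : PadicAlgCl 2) * P.2 ^ k / (1 - 2 * P.1))‖ ≤ ρK⁻¹ ∧
        ρK ≤ ‖(p.map (algebraMap ℚ (PadicAlgCl 2))).eval (P.2⁻¹ + (c : PadicAlgCl 2) * P.2 ^ k / (1 - 2 * P.1)) /
            (q.map (algebraMap ℚ (PadicAlgCl 2))).eval (P.2⁻¹ + (c : PadicAlgCl 2) * P.2 ^ k / (1 - 2 * P.1)) - 1‖) := by
    intro K hK
    rw [Set.Finite.mem_toFinset] at hK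
    haveI : FiniteDimensional ℚ_[2] K.toSubalgebra.toSubmodule := hK.1
    obtain ⟨ρK, h0, h1, h⟩ := exists_annulus_of_far_fibre_c_of_submodule (L := PadicAlgCl 2)
      K.toSubalgebra.toSubmodule he hk hc2 hpn2 hqn2 hpqn2 hp02 hq02 hne2 hρ
    exact ⟨ρK, h0, h1, h⟩
  obtain ⟨ρ₂, hρ₂0, hρ₂⟩ := exists_pos_forall_of_antitoneC h𝒦fin.toFinset _
    (fun K m m' hm' hle hQ => ⟨hle.trans hQ.1, fun P h1 h2 h3 h4 h5 h6 => by
        obtain ⟨a, b, c⟩ := hQ.2 P h1 h2 h3 h4 h5 h6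
        exact ⟨hle.trans a, b.trans (inv_anti₀ hm' hle), hle.trans c⟩⟩) hperK
  -- the uniform constant
  refine ⟨min (1 / 2) (min (ρ₁ / 2) ρ₂), by positivity, min_le_left _ _, ?_⟩
  intro F _ _ hF x r hcurve hr hs hfarC hfar2
  set t : F := r⁻¹ + (c : F) * r ^ k / (1 - 2 * x) with ht
  constructor
  · -- archimedean conjugates: STRICT inequalities from ρ₁/2 < ρ₁
    intro σ
    have hct : σ t = (σ r)⁻¹ + (c : _) * (σ r) ^ k / (1 - 2 * σ x) := map_tDeC σ c x r k
    have hcz : σ (aeval t p / aeval t q) = aeval (σ t) p / aeval (σ t) q := map_phiDeC σ p q t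
    have hcurveσ : (σ r) ^ e = σ x * (1 - σ x) := by
      have := congrArg σ hcurve; simpa [map_pow, map_mul, map_sub, map_one] using this
    have hrσ : σ r ≠ 0 := (map_ne_zero σ).mpr hr
    have hsσ : 1 - 2 * σ x ≠ 0 := by
      have := (map_ne_zero σ).mpr hs; simpa [map_sub, map_mul, map_one, map_ofNat] using this
    have h := harc (σ x, σ r) hcurveσ hrσ hsσ (fun P' h1 h2 h3 h4 => hfarC σ P' h1 h2 h3
      ((fibre_aeval_iffC p q _).mpr h4))
    rw [← aeval_eq_eval_mapC, ← aeval_eq_eval_mapC] at h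
    obtain ⟨ha, hb, hc⟩ := h
    change min (1 / 2) (min (ρ₁ / 2) ρ₂) < ‖σ (aeval t p / aeval t q)‖ ∧
      ‖σ (aeval t p / aeval t q)‖ < (min (1 / 2) (min (ρ₁ / 2) ρ₂))⁻¹ ∧
      min (1 / 2) (min (ρ₁ / 2) ρ₂) < ‖σ (aeval t p / aeval t q) - 1‖
    rw [hcz, hct]
    have hm : min (1 / 2) (min (ρ₁ / 2) ρ₂) ≤ ρ₁ / 2 := (min_le_right _ _).trans (min_le_left _ _)
    have hlt : ρ₁ / 2 < ρ₁ := by linarith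
    refine ⟨lt_of_le_of_lt hm (lt_of_lt_of_le hlt ha), lt_of_le_of_lt hb ?_,
      lt_of_le_of_lt hm (lt_of_lt_of_le hlt hc)⟩
    exact inv_strictAnti₀ (by positivity) (lt_of_le_of_lt hm hlt)
  · -- 2-adic conjugates
    intro p' hp' inst σ
    rw [Finset.mem_singleton] at hp'
    subst hp'
    have hct : σ t = (σ r)⁻¹ + (c : _) * (σ r) ^ k / (1 - 2 * σ x) := map_tDeC σ c x r k
    have hcz : σ (aeval t p / aeval t q) = aeval (σ t) p / aeval (σ t) q := map_phiDeC σ p q t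
    have hcurveσ : (σ r) ^ e = σ x * (1 - σ x) := by
      have := congrArg σ hcurve; simpa [map_pow, map_mul, map_sub, map_one] using this
    have hrσ : σ r ≠ 0 := (map_ne_zero σ).mpr hr
    have hsσ : 1 - 2 * σ x ≠ 0 := by
      have := (map_ne_zero σ).mpr hs; simpa [map_sub, map_mul, map_one, map_ofNat] using this
    -- the subfield `K = ℚ_2⟮σx⟯ ⊔ ℚ_2⟮σr⟯`, of degree ≤ N * N
    let τ : F →ₐ[ℚ] PadicAlgCl 2 := σ.toRatAlgHom
    have hint : ∀ y : F, IsIntegral ℚ_[2] (σ y) := fun y => by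
      have hQ : IsIntegral ℚ (σ y) := by
        rw [show σ y = τ y from rfl]; exact (Algebra.IsIntegral.isIntegral (R := ℚ) y).map τ
      exact hQ.tower_top
    have hdegle : ∀ y : F, Module.finrank ℚ_[2] (IntermediateField.adjoin ℚ_[2]
        ({σ y} : Set (PadicAlgCl 2))) ≤ N := fun y => by
      have hQ : IsIntegral ℚ (σ y) := by
        rw [show σ y = τ y from rfl]; exact (Algebra.IsIntegral.isIntegral (R := ℚ) y).map τ
      rw [IntermediateField.adjoin.finrank (hint y)]
      have h1 : minpoly ℚ_[2] (σ y) ∣ (minpoly ℚ (σ y)).map (algebraMap ℚ ℚ_[2]) :=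
        minpoly.dvd_map_of_isScalarTower ℚ ℚ_[2] (σ y)
      have hne' : (minpoly ℚ (σ y)).map (algebraMap ℚ ℚ_[2]) ≠ 0 :=
        Polynomial.map_ne_zero (minpoly.ne_zero hQ)
      have h2 := Polynomial.natDegree_le_of_dvd h1 hne'
      rw [Polynomial.natDegree_map, show σ y = τ y from rfl, minpoly.algHom_eq τ σ.injective y] at h2
      exact h2.trans ((minpoly.natDegree_le y).trans hF)
    set Kx := IntermediateField.adjoin ℚ_[2] ({σ x} : Set (PadicAlgCl 2)) with hKx
    set Kr := IntermediateField.adjoin ℚ_[2] ({σ r} : Set (PadicAlgCl 2)) with hKr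
    haveI : FiniteDimensional ℚ_[2] Kx := IntermediateField.adjoin.finiteDimensional (hint x)
    haveI : FiniteDimensional ℚ_[2] Kr := IntermediateField.adjoin.finiteDimensional (hint r)
    set K := Kx ⊔ Kr with hK
    have hKfd : FiniteDimensional ℚ_[2] K := IntermediateField.finiteDimensional_sup Kx Kr
    have hKdeg : Module.finrank ℚ_[2] K ≤ N * N :=
      (IntermediateField.finrank_sup_le Kx Kr).trans (Nat.mul_le_mul (hdegle x) (hdegle r))
    have hKmem : K ∈ h𝒦fin.toFinset := by
      rw [Set.Finite.mem_toFinset]; exact ⟨hKfd, hKdeg⟩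
    have hxK : σ x ∈ K.toSubalgebra.toSubmodule :=
      (le_sup_left : Kx ≤ K) (IntermediateField.mem_adjoin_simple_self ℚ_[2] _)
    have hrK : σ r ∈ K.toSubalgebra.toSubmodule :=
      (le_sup_right : Kr ≤ K) (IntermediateField.mem_adjoin_simple_self ℚ_[2] _)
    obtain ⟨-, hKall⟩ := hρ₂ K hKmem
    have h := hKall (σ x, σ r) hxK hrK hcurveσ hrσ hsσ (fun P' h1 h2 h3 h4 => hfar2 σ P' h1 h2 h3
      ((fibre_aeval_iffC p q _).mpr h4))
    rw [← aeval_eq_eval_mapC, ← aeval_eq_eval_mapC] at h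
    obtain ⟨ha, hb, hc⟩ := h
    change min (1 / 2) (min (ρ₁ / 2) ρ₂) ≤ ‖σ (aeval t p / aeval t q)‖ ∧
      ‖σ (aeval t p / aeval t q)‖ ≤ (min (1 / 2) (min (ρ₁ / 2) ρ₂))⁻¹ ∧
      min (1 / 2) (min (ρ₁ / 2) ρ₂) ≤ ‖σ (aeval t p / aeval t q) - 1‖
    rw [hcz, hct]
    have hm : min (1 / 2) (min (ρ₁ / 2) ρ₂) ≤ ρ₂ := (min_le_right _ _).trans (min_le_right _ _)
    exact ⟨hm.trans ha, hb.trans (inv_anti₀ (by positivity) hm), hm.trans hc⟩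

/-- **W7 for the family `t_c`, `x`-coordinate form**: it suffices that
every conjugate `σx` be `ρ`-far from the `x`-COORDINATES of the fibre points.
[cite: MochizukiGenEll2010, Thm 2.1 p.12] -/
theorem exists_farFromCusps_phi_c_of_x_far {e k : ℕ} (he : 0 < e) (hk : 2 * k = e + 1) {c : ℚ}
    (hc : c ≠ 0) {p q : ℚ[X]}
    {n : ℕ} (hpn : p.natDegree = n) (hqn : q.natDegree = n) (hpqn : (p - q).natDegree = n)
    (hp0 : p ≠ 0) (hq0 : q ≠ 0) (hne : p ≠ q) {ρ : ℝ} (hρ : 0 < ρ) (N : ℕ) :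
    ∃ ρ' : ℝ, 0 < ρ' ∧ ρ' ≤ 1 / 2 ∧
      ∀ (F : Type) [Field F] [NumberField F], Module.finrank ℚ F ≤ N →
      ∀ (x r : F), r ^ e = x * (1 - x) → r ≠ 0 → 1 - 2 * x ≠ 0 →
      (∀ σ : F →+* ℂ, ∀ P' : ℂ × ℂ, P'.2 ^ e = P'.1 * (1 - P'.1) → P'.2 ≠ 0 → 1 - 2 * P'.1 ≠ 0 →
        (aeval (P'.2⁻¹ + (c : ℂ) * P'.2 ^ k / (1 - 2 * P'.1)) p = 0 ∨
          aeval (P'.2⁻¹ + (c : ℂ) * P'.2 ^ k / (1 - 2 * P'.1)) q = 0 ∨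
          aeval (P'.2⁻¹ + (c : ℂ) * P'.2 ^ k / (1 - 2 * P'.1)) (p - q) = 0) →
        ρ ≤ ‖σ x - P'.1‖) →
      (∀ σ : F →+* PadicAlgCl 2, ∀ P' : PadicAlgCl 2 × PadicAlgCl 2,
        P'.2 ^ e = P'.1 * (1 - P'.1) → P'.2 ≠ 0 → 1 - 2 * P'.1 ≠ 0 →
        (aeval (P'.2⁻¹ + (c : PadicAlgCl 2) * P'.2 ^ k / (1 - 2 * P'.1)) p = 0 ∨
          aeval (P'.2⁻¹ + (c : PadicAlgCl 2) * P'.2 ^ k / (1 - 2 * P'.1)) q = 0 ∨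
          aeval (P'.2⁻¹ + (c : PadicAlgCl 2) * P'.2 ^ k / (1 - 2 * P'.1)) (p - q) = 0) →
        ρ ≤ ‖σ x - P'.1‖) →
      NFPoint.FarFromCusps ({2} : Finset ℕ) ρ'
        ⟨F, aeval (r⁻¹ + (c : F) * r ^ k / (1 - 2 * x)) p /
          aeval (r⁻¹ + (c : F) * r ^ k / (1 - 2 * x)) q⟩ := by
  obtain ⟨ρ', h0, h1, h⟩ := exists_farFromCusps_phi_c he hk hc hpn hqn hpqn hp0 hq0 hne hρ N
  refine ⟨ρ', h0, h1, fun F _ _ hF x r hcurve hr hs hC h2 => h F hF x r hcurve hr hs ?_ ?_⟩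
  · intro σ P' h1' h2' h3' h4'
    calc ρ ≤ ‖σ x - P'.1‖ := hC σ P' h1' h2' h3' h4'
      _ = dist ((σ x, σ r) : ℂ × ℂ).1 P'.1 := (dist_eq_norm _ _).symm
      _ ≤ dist ((σ x, σ r) : ℂ × ℂ) P' := by rw [Prod.dist_eq]; exact le_max_left _ _
  · intro σ P' h1' h2' h3' h4'
    calc ρ ≤ ‖σ x - P'.1‖ := h2 σ P' h1' h2' h3' h4'
      _ = dist ((σ x, σ r) : PadicAlgCl 2 × PadicAlgCl 2).1 P'.1 := (dist_eq_norm _ _).symm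
      _ ≤ dist ((σ x, σ r) : PadicAlgCl 2 × PadicAlgCl 2) P' := by
          rw [Prod.dist_eq]; exact le_max_left _ _

end NumberField

end Literature.NumberTheory.DiophantineGeometry.GenEll
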